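import Mathlib

/-!
# Imbrie (2016), §4.2.1: the single-vertex floating fraction under the printed definitions;
lace-line count (Appendix A); the (A.3)/(6.2) Leibniz identity — AUDIT-CELL LEMMAS
(kernel-checked arithmetic/algebra only)

CITATION HEADER (audit cell pub-imbrie, build tag b2b; seat b2b-imbrie-2-g5).
Source audited: J. Z. Imbrie, "On Many-Body Localization for Quantum Spin Chains",
J. Stat. Phys. 163 (2016) 998–1048, doi 10.1007/s10955-016-1508-x = arXiv:1403.7837v3
(bib key ImbrieJSP2016).  Passages (arXiv v3 TeX, chunk locators pNNNN l.N of the cell's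
SOURCES.md; journal = JSP):
* (4.4) [p0015 l.29–33]: "the length |g_{(j-1)''}| is defined to be the sum of the lengths of its
  subgraphs, if g_{(j-1)''} is not a jump step. The length of a jump step on an interval I is
  defined for any i to be |g_{i''}| = |I| ∨ (7/8) L_i".
* (4.3) [p0015 l.16–27]: "g_{(j-1)''}! ≡ 1 if g_{(j-1)''} is a jump step; n! ∏_{p=0}^n g_{(j-2)'',p}!
  otherwise"; [p0024 l.4] "The factorials 1/n! and n/(n+1)! ≤ 1/n! from the ad expansion accumulate
  exactly as per the definition (4.3)".
* (4.8) [p0016]: "II. A^{(k)prov}(ḡ_{j'}) > (γ/ε)^{|ḡ_{j'}|}/(ḡ_{j'}!)^{2/9} with |I(ḡ_{j'})| ≥ (7/8)|ḡ_{j'}|";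
  [p0018 l.16] "we say a graph g_{j'} is long if |g_{j'}| > (8/7)|I(g_{j'})|. Otherwise, it is short."
* §4.2.1 [p0018 l.18] (JSP p.1018): "We claim that no more than 2n/9 graphs g_{(i-1)',p} can fail to
  break new ground. … consider first the case with no gaps. The ratio ℓ_p : ℓ_f … must be at least
  7:1. The lengths of graphs vary by no more than a factor of 15/8 < 2. Hence the ratio n_p : n_f …
  must be at least 7:2 … If gaps are present, then (as explained in Section 4.3) the graphs bridging
  the gaps double back. This means that half the length of the bridging graphs is 'wasted,' i.e. it
  does not extend I(g_{i'}). … suppose that the length of the pinned graphs plus the length of the gap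
  graphs is ℓ_p(1+δ). Then … ℓ_f ≤ ℓ_p(1-5δ/2)/7 … n_f/n is no greater than (2-5δ)/(9-5δ) ≤ 2/9".
* [p0030 l.13]: "the minimum size of a graph g_{j''} in an A^{(k)} term is (7/8)L_{k-1}";
  (4.25) [p0028]: J^{(j')per} = graphs with L_{k-1} ≤ |g| < L_k.
* §4.3.2 [p0029 l.16–17]: "The double-back nature of the energy graphs implies that their graph
  length |g_{i'}| is at least twice the length of the intervals spanned, I(g_{i'}). Hence they all
  become jump steps g_{i''}"; [p0029 l.19] range ½(L_j + L_{j-1} + …) ≤ (15/14)L_j; [p0030 l.9–10]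
  "g_k includes the additional gap graphs as subgraphs. As for other jump steps … like jump steps,
  they do not contribute factorials to (4.3)"; [p0018 l.16] "gaps of size ≤ (15/14)L_{i-1}".
* §4.2.3 [p0024 l.13–14]: "we take s = 2/7 … (ḡ_{j'}!)^{7s/9} = (ḡ_{j'}!)^{2/9}"; [p0030] "(4.17)
  requires s < 1/3" (tripled denominators).
* Appendix A [p0036 l.24] = JSP App. 1 (journal p.1046): "Each subsequent line maximizes the reach to
  the right from any of the groups spanned by the expanding lace graph" / "always choosing the line
  reaching the group farthest to the right from the groups spanned by the expanding lace graph";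
  "The lace graph has the property that no more than two lines emanate from any group."
* (A.3) [p0037] = JSP (6.2): "… = (d21-d22)(d21-d22)/(d22 d21 d12) + [(d21-d22)-(d11-d12)]/(d12 d21)
  + (d11-d21)(d11-d12)/(d12 d21 d11)".

WHAT THIS FILE IS.  Def-free lemmas used by the cell's rev.-6 adjudication (SURVIVAL.md §4E′ (iv⁗)).
UNITS: lengths at a step-i vertex in units of L_i, so L_{i-1} = 8/15, a short child has length in
[8/15, 1), a jump-step child has booked length in [7/15, 7/8) by (4.4), the largest span of a single
scale-(i-1) energy graph is ½L_{i-1} = 4/15, the range is (15/14)L_{i-1} = 4/7.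
(1) From the shortness inequality |g| ≤ (8/7)|I(g)| alone: n_f·F ≤ n_p·(P/7 + (8/7)G − B) + z, where
P = pinned child length, G = gap size (extends I), B = booked gap-graph length (adds to |g|), F =
floating child length, z = zeroth-factor slack.  (2) Instances: with no gaps but jump-step floating
children (F = 7/15, P → 1) the floating fraction reaches 15/64 > 2/9 (the printed "15/8 < 2" is 15/7
once the (7/8)L_{i-1} floor of (4.4) is admitted); it stays below 1/4 and is affordable iff s ≥ 15/49
(< 1/3).  With ONE maximal scale-(i-1) gap graph per pinned child booked by (4.4) at its span (nothing
wasted: G = B = 4/15) the fraction is 19/68 (short pinned) / 137/529 (jump pinned) > 1/4, and with full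
chains (G = B = 4/7) 165/508 > 1/4 — beyond every exponent a ≤ s/(1+s) < 1/4 [TrunkCounting:
counting_exponent_lt_quarter].  The printed model (half of B wasted: G = B/2, F ≥ P/2) gives the
printed (1−3δ)-type decrease.  Critical wasted fractions w (G = (1−w)B) at which a < 1/4 becomes
affordable again: 19/768 (jump pinned, one element), 19/180 (short pinned, full chain).
(3) For every constant C ≥ 1, a floating fraction φ > a defeats the budget: ∃ n, Cⁿ(n!)ᵃ < n^{φn}.
(4) Lace lines: strictly increasing right endpoints ⇒ #lines ≤ #groups − 1, so the total gap-chain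
length at a vertex with n children is ≤ n·(4/7) and the GLOBAL load per child is ≤ 11/7 < 7/4 even
though two lace lines may cross one gap (referee G43's local doubling; its arithmetic 8/63 − 14/135 =
22/945 is reproduced as arithmetic).  (5) (A.3)/(6.2): the first numerator should read
(d21−d22)(d12−d22); the printed (d21−d22)² is not an identity (explicit rationals) — harmless typo.
These are AUDIT-CELL LEMMAS about elementary quantities, NOT statements of the paper; whether the
paper's graph classes realise the parameter values is argued in SURVIVAL.md from the quoted
definitions, not here.  Cell verdict unchanged (LLA open; LLA-free part conditional on §4.2.1).
-/

namespace Literature.MathematicalPhysics.QuantumLattice.Imbrie2016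

open Real

/-! ## 1. The single-vertex slack inequality (from |g| ≤ (8/7)|I(g)| only) -/

/-- Shortness `|g| ≤ (8/7)|I(g)|` at one vertex: `np` pinned children of length `P`, each placed
beyond a gap of size `G` bridged by gap graphs of total booked length `B`; `nf` floating children
of length `F`; `z` = slack contributed by the zeroth factor.  Then the floating length is bounded
by the pinned count times `P/7 + (8/7)G − B`. [cite: ImbrieJSP2016, (4.8)II and §4.2.1 "ratio … at least 7:1"] -/
theorem floating_length_le {np nf P G B F z : ℝ}
    (h : np * P + np * B + nf * F ≤ 8 / 7 * (np * P + np * G) + z) :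
    nf * F ≤ np * (P / 7 + 8 / 7 * G - B) + z := by
  have e : np * (P / 7 + 8 / 7 * G - B) = np * P / 7 + 8 / 7 * (np * G) - np * B := by ring
  rw [e]; linarith

/-- Ratio-to-fraction: `nf ≤ q·np` gives floating fraction `nf/(np+nf) ≤ q/(1+q)`. [folklore] -/
theorem floating_fraction_le {np nf q : ℝ} (hnp : 0 < np) (hnf : 0 ≤ nf) (hq : 0 ≤ q)
    (h : nf ≤ q * np) : nf / (np + nf) ≤ q / (1 + q) := by
  have h1 : 0 < np + nf := by linarith
  have h2 : 0 < 1 + q := by linarith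
  rw [div_le_div_iff₀ h1 h2]
  nlinarith

/-- The printed "half wasted" model: gap graphs of booked length `B = δ·P` extend `I` by `B/2`.
With `P = 1`: slack per pinned child `(1 − 3δ)/7` (the sharp form of the printed `(1 − 5δ/2)/7`,
cf. GeneralStepConstants.floatingLength_le). [cite: ImbrieJSP2016, §4.2.1 "half the length of the bridging graphs is 'wasted'"] -/
theorem halfWasted_slack (δ : ℝ) : (1 : ℝ) / 7 + 8 / 7 * (δ / 2) - δ = (1 - 3 * δ) / 7 := by ring

/-- General wasted fraction `w` of the booked gap length (`G = (1 − w)·B`): slack per pinned child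
`(P + B(1 − 8w))/7`; gaps INCREASE the slack iff `w < 1/8`. (Audit-cell algebra.) [cite: ImbrieJSP2016, §4.2.1 "it does not extend I(g_{i'})" and (4.4)] -/
theorem waste_slack (P B w : ℝ) :
    P / 7 + 8 / 7 * ((1 - w) * B) - B = (P + B * (1 - 8 * w)) / 7 := by ring

/-! ## 2. Instances in units of L_i (L_{i-1} = 8/15) -/

/-- Child-length range under (4.4)/(4.25): short children in `[8/15, 1)`, jump steps in
`[7/15, 7/8)`; the extreme ratio is `15/7 > 2`, not the printed `15/8 < 2` (which is the ratio
among SHORT children only). [cite: ImbrieJSP2016, §4.2.1 "vary by no more than a factor of 15/8 < 2"; (4.4); p.1031 "minimum size … (7/8)L_{k-1}"] -/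
theorem child_length_ratios :
    (7 : ℝ) / 8 * (8 / 15) = 7 / 15 ∧ (1 : ℝ) / (7 / 15) = 15 / 7 ∧ (2 : ℝ) < 15 / 7 ∧
    (1 : ℝ) / (8 / 15) = 15 / 8 ∧ (15 : ℝ) / 8 < 2 := by norm_num

/-- F1 (no gaps, short pinned `P = 1`, jump floating `F = 7/15`): ratio `15/49`, fraction `15/64`,
which exceeds the printed `2/9` by `7/576` but stays below `1/4`. (Audit-cell arithmetic.) [cite: ImbrieJSP2016, §4.2.1 "must be at least 7:2" with (4.4)] -/
theorem noGap_ratio : ((1 : ℝ) / 7 + 8 / 7 * 0 - 0) / (7 / 15) = 15 / 49 := by norm_num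

/-- F1 fraction `15/64`, excess `7/576` over `2/9`, below `1/4`. (Audit-cell arithmetic.) [cite: ImbrieJSP2016, §4.2.1 "no more than 2n/9"] -/
theorem noGap_fraction :
    (15 / 49 : ℝ) / (1 + 15 / 49) = 15 / 64 ∧ (2 : ℝ) / 9 < 15 / 64 ∧
    (15 : ℝ) / 64 - 2 / 9 = 7 / 576 ∧ (15 : ℝ) / 64 < 1 / 4 := by norm_num

/-- With jump-step PINNED children (`P = 7/8`) and no gaps the printed claim survives:
fraction `15/71 < 2/9`.  So F1 needs short pinned children of length near `L_i`. (Audit-cell arithmetic.) [cite: ImbrieJSP2016, §4.2.1 and (4.4)] -/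
theorem noGap_jumpPinned_fraction :
    ((7 / 8 : ℝ) / 7 + 8 / 7 * 0 - 0) / (7 / 15) = 15 / 56 ∧
    (15 / 56 : ℝ) / (1 + 15 / 56) = 15 / 71 ∧ (15 : ℝ) / 71 < 2 / 9 := by norm_num

/-- F1 is affordable inside the scheme: a counting exponent `15/64` fits under `s/(1+s)` iff
`s ≥ 15/49`, and `15/49 < 1/3`; e.g. `s = 5/16` gives `a = 5/21 > 15/64`.
[cite: ImbrieJSP2016, §4.2.3 "we take s = 2/7"; "(4.17) requires s < 1/3"] -/
theorem noGap_affordable_iff {s : ℝ} (hs : 0 < s) :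
    (15 : ℝ) / 64 ≤ s / (1 + s) ↔ 15 / 49 ≤ s := by
  rw [le_div_iff₀ (by linarith)]
  constructor <;> intro h <;> linarith

/-- The window `s ∈ [15/49, 1/3)` is non-empty; `s = 5/16 ↦ a = 5/21 > 15/64`; the printed `s = 2/7` (a = 2/9) is NOT enough. (Audit-cell arithmetic.) [cite: ImbrieJSP2016, §4.2.3 "we take s = 2/7"] -/
theorem noGap_affordable_window :
    (15 : ℝ) / 49 < 1 / 3 ∧ (5 / 16 : ℝ) / (1 + 5 / 16) = 5 / 21 ∧
    (15 : ℝ) / 64 < 5 / 21 ∧ (5 : ℝ) / 16 < 1 / 3 ∧ ¬ ((15 : ℝ) / 64 ≤ (2 / 7) / (1 + 2 / 7)) := by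
  norm_num

/-- Parameters of ONE maximal scale-(i-1) gap graph booked by (4.4): largest span `½L_{i-1} = 4/15`;
the (4.4) floor `(7/8)L_{i-2} = 56/225 < 4/15`, so for spans in `[56/225, 4/15)` the booked length
equals the span (wasted fraction `w = 0`); and `4/15` is within the range `(15/14)L_{i-1} = 4/7`.
[cite: ImbrieJSP2016, §4.3.2 "range ½(L_j + L_{j-1} + …) ≤ (15/14)L_j"; (4.4)] -/
theorem oneElement_params :
    (1 : ℝ) / 2 * (8 / 15) = 4 / 15 ∧ (7 : ℝ) / 8 * (8 / 15) ^ 2 = 56 / 225 ∧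
    (56 : ℝ) / 225 < 4 / 15 ∧ (15 : ℝ) / 14 * (8 / 15) = 4 / 7 ∧ (4 : ℝ) / 15 < 4 / 7 := by
  norm_num

/-- F2, short pinned (`P = 1`), one unwasted maximal element per gap (`G = B = 4/15`), jump floating:
ratio `19/49`, fraction `19/68 > 1/4`. (Audit-cell arithmetic.) [cite: ImbrieJSP2016, §4.3.2 "they all become jump steps" with (4.4)] -/
theorem oneElement_shortPinned :
    ((1 : ℝ) / 7 + 8 / 7 * (4 / 15) - 4 / 15) / (7 / 15) = 19 / 49 ∧
    (19 / 49 : ℝ) / (1 + 19 / 49) = 19 / 68 ∧ (1 : ℝ) / 4 < 19 / 68 := by norm_num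

/-- F2a, ALL children jump steps (`P = 7/8`, factorial exactly 1 by (4.3)), one unwasted maximal
element per gap, jump floating: ratio `137/392`, fraction `137/529 > 1/4`. (Audit-cell arithmetic.) [cite: ImbrieJSP2016, (4.3) "g! ≡ 1 if g is a jump step" with (4.4)] -/
theorem oneElement_jumpPinned :
    ((7 / 8 : ℝ) / 7 + 8 / 7 * (4 / 15) - 4 / 15) / (7 / 15) = 137 / 392 ∧
    (137 / 392 : ℝ) / (1 + 137 / 392) = 137 / 529 ∧ (1 : ℝ) / 4 < 137 / 529 := by norm_num

/-- F2b, short pinned, full unwasted chain per gap (`G = B = 4/7`): ratio `165/343`, fraction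
`165/508 > 1/4`; with jump pinned: `1215/3959 > 1/4`. (Audit-cell arithmetic.) [cite: ImbrieJSP2016, §4.2.1 "gaps of size ≤ (15/14)L_{i-1}" with (4.4)] -/
theorem fullChain_fractions :
    ((1 : ℝ) / 7 + 8 / 7 * (4 / 7) - 4 / 7) / (7 / 15) = 165 / 343 ∧
    (165 / 343 : ℝ) / (1 + 165 / 343) = 165 / 508 ∧ (1 : ℝ) / 4 < 165 / 508 ∧
    ((7 / 8 : ℝ) / 7 + 8 / 7 * (4 / 7) - 4 / 7) / (7 / 15) = 1215 / 2744 ∧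
    (1215 / 2744 : ℝ) / (1 + 1215 / 2744) = 1215 / 3959 ∧ (1 : ℝ) / 4 < 1215 / 3959 := by
  norm_num

/-- No fractional-moment exponent repairs F2: a fraction `> 1/4` is never `≤ s/(1+s)` with
`0 < s < 1/3`. (Cf. TrunkCounting.counting_exponent_lt_quarter.) [cite: ImbrieJSP2016, §4.3.2 "(4.17) requires s < 1/3"] -/
theorem not_affordable_above_quarter {φ s : ℝ} (hφ : 1 / 4 < φ) (hs₀ : 0 < s) (hs : s < 1 / 3) :
    ¬ (φ ≤ s / (1 + s)) := by
  intro h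
  rw [le_div_iff₀ (by linarith)] at h
  nlinarith

/-- Critical wasted fraction, F2a family (jump pinned, one element `B = 4/15`, `G = (1−w)B`):
the floating ratio is `≤ 1/3` (i.e. fraction `≤ 1/4`) iff `w ≥ 19/768`; and `≤ 2/7` (the printed
exponent `2/9`) iff `w ≥ 25/256`.  The printed argument asserts `w = 1/2`. (Audit-cell arithmetic.) [cite: ImbrieJSP2016, §4.2.1 "half the length of the bridging graphs is 'wasted'"] -/
theorem critical_waste_oneElement_jumpPinned (w : ℝ) :
    (((7 : ℝ) / 8 + 4 / 15 * (1 - 8 * w)) / 7 / (7 / 15) ≤ 1 / 3 ↔ 19 / 768 ≤ w) ∧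
    (((7 : ℝ) / 8 + 4 / 15 * (1 - 8 * w)) / 7 / (7 / 15) ≤ 2 / 7 ↔ 25 / 256 ≤ w) := by
  constructor <;> (constructor <;> intro h <;> linarith)

/-- Critical wasted fraction, F2b family (short pinned, full chain `B = 4/7`): fraction `≤ 1/4`
iff `w ≥ 19/180`. (Audit-cell arithmetic.) [cite: ImbrieJSP2016, §4.2.1 "half the length of the bridging graphs is 'wasted'"] -/
theorem critical_waste_fullChain_shortPinned (w : ℝ) :
    ((1 : ℝ) + 4 / 7 * (1 - 8 * w)) / 7 / (7 / 15) ≤ 1 / 3 ↔ 19 / 180 ≤ w := by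
  constructor <;> intro h <;> linarith

/-! ## 3. A floating fraction above the exponent defeats every constant -/

/-- If ordered configurations number `≳ n^{φ n}` while the budget is `Cⁿ (n!)ᵃ` with `a < φ`, the
budget fails for some `n`, whatever the constant `C ≥ 1`.  (Uses only `n! ≤ nⁿ`.) [folklore] -/
theorem count_exceeds_budget {φ a C : ℝ} (ha : 0 ≤ a) (hφ : a < φ) (hC : 1 ≤ C) :
    ∃ n : ℕ, 2 ≤ n ∧ C ^ n * ((n.factorial : ℕ) : ℝ) ^ a < (n : ℝ) ^ (φ * n) := by
  have hd : 0 < φ - a := by linarith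
  set y : ℝ := C ^ (1 / (φ - a)) with hy
  have hy0 : 0 ≤ y := by positivity
  set n : ℕ := ⌈y⌉₊ + 2 with hn
  have hn2 : 2 ≤ n := by omega
  have hnpos : (0 : ℝ) < n := by exact_mod_cast (show 0 < n by omega)
  have hyn : y < n := by
    have := Nat.le_ceil y
    have : (⌈y⌉₊ : ℝ) + 2 = (n : ℝ) := by simp [hn]
    linarith
  refine ⟨n, hn2, ?_⟩
  -- C < n^(φ - a)
  have hCn : C < (n : ℝ) ^ (φ - a) := by
    have h1 : y ^ (φ - a) < (n : ℝ) ^ (φ - a) := Real.rpow_lt_rpow hy0 hyn hd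
    have h2 : y ^ (φ - a) = C := by
      rw [hy, ← Real.rpow_mul (by linarith)]
      rw [show (1 / (φ - a)) * (φ - a) = 1 by field_simp]
      simp
    linarith
  -- C^n < n^((φ - a) n)
  have hpow : C ^ n < ((n : ℝ) ^ (φ - a)) ^ n :=
    pow_lt_pow_left₀ hCn (by linarith) (by omega)
  have hpow' : ((n : ℝ) ^ (φ - a)) ^ n = (n : ℝ) ^ ((φ - a) * n) := by
    rw [Real.rpow_mul_natCast hnpos.le]
  -- (n!)^a ≤ n^(a n)
  have hfact : ((n.factorial : ℕ) : ℝ) ^ a ≤ (n : ℝ) ^ (a * n) := by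
    have hle : ((n.factorial : ℕ) : ℝ) ≤ (n : ℝ) ^ (n : ℕ) := by
      exact_mod_cast Nat.factorial_le_pow n
    calc ((n.factorial : ℕ) : ℝ) ^ a ≤ ((n : ℝ) ^ (n : ℕ)) ^ a :=
          Real.rpow_le_rpow (by positivity) hle ha
      _ = (n : ℝ) ^ ((n : ℝ) * a) := by rw [Real.rpow_natCast_mul hnpos.le]
      _ = (n : ℝ) ^ (a * n) := by rw [mul_comm]
  have hsplit : (n : ℝ) ^ (φ * n) = (n : ℝ) ^ ((φ - a) * n) * (n : ℝ) ^ (a * n) := by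
    rw [← Real.rpow_add hnpos]; congr 1; ring
  rw [hsplit]
  have hCpos : 0 < C ^ n := by positivity
  have hfpos : 0 < ((n.factorial : ℕ) : ℝ) ^ a := by
    apply Real.rpow_pos_of_pos; exact_mod_cast Nat.factorial_pos n
  calc C ^ n * ((n.factorial : ℕ) : ℝ) ^ a
      < ((n : ℝ) ^ (φ - a)) ^ n * ((n.factorial : ℕ) : ℝ) ^ a :=
        mul_lt_mul_of_pos_right hpow hfpos
    _ ≤ ((n : ℝ) ^ (φ - a)) ^ n * (n : ℝ) ^ (a * n) :=
        mul_le_mul_of_nonneg_left hfact (by positivity)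
    _ = (n : ℝ) ^ ((φ - a) * n) * (n : ℝ) ^ (a * n) := by rw [hpow']

/-- The instances that matter: the printed exponent `2/9` against the no-gap fraction `15/64`,
and every affordable exponent `a < 1/4` against `137/529`. (Audit-cell lemma.) [cite: ImbrieJSP2016, §4.2.1 "combinatoric factors c^{|g_{j'}|}(g_{j'}!)^{2/9} will be sufficient"] -/
theorem noGap_defeats_two_ninths (C : ℝ) (hC : 1 ≤ C) :
    ∃ n : ℕ, 2 ≤ n ∧ C ^ n * ((n.factorial : ℕ) : ℝ) ^ (2 / 9 : ℝ) < (n : ℝ) ^ ((15 / 64 : ℝ) * n) :=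
  count_exceeds_budget (by norm_num) (by norm_num) hC

/-- Every exponent `a < 1/4` (all that `s < 1/3` affords) loses to the fraction `137/529`. (Audit-cell lemma.) [cite: ImbrieJSP2016, §4.2.1 and §4.3.2 "(4.17) requires s < 1/3"] -/
theorem oneElement_defeats_every_affordable {a : ℝ} (ha₀ : 0 ≤ a) (ha : a < 1 / 4) (C : ℝ)
    (hC : 1 ≤ C) :
    ∃ n : ℕ, 2 ≤ n ∧ C ^ n * ((n.factorial : ℕ) : ℝ) ^ a < (n : ℝ) ^ ((137 / 529 : ℝ) * n) :=
  count_exceeds_budget ha₀ (by linarith) hC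

/-! ## 4. Lace lines (Appendix A): #lines ≤ #groups − 1, so the global gap load is unchanged -/

/-- In the lace construction the right endpoints `r 0 < r 1 < …` of successive lines strictly
increase (each new line reaches strictly farther right), the first ends at group `≥ 2` and all
end at groups `≤ G`.  Hence the number `T` of lace lines satisfies `T + 1 ≤ G`.
[cite: ImbrieJSP2016, App. A "Each subsequent line maximizes the reach to the right"] -/
theorem lace_lines_le {T G : ℕ} (r : ℕ → ℕ) (hmono : ∀ t, t + 1 < T → r t < r (t + 1))
    (h0 : 0 < T → 2 ≤ r 0) (hG : ∀ t, t < T → r t ≤ G) : T + 1 ≤ G ∨ T = 0 := by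
  rcases Nat.eq_zero_or_pos T with hT | hT
  · exact Or.inr hT
  · left
    have key : ∀ t, t < T → t + 2 ≤ r t := by
      intro t
      induction t with
      | zero => intro _; simpa using h0 hT
      | succ t ih =>
          intro ht
          have h1 := hmono t ht
          have h2 := ih (by omega)
          omega
    have h3 := key (T - 1) (by omega)
    have h4 := hG (T - 1) (by omega)
    omega

/-- Consequently, with at most one chain of booked length `≤ 4/7` (units of `L_i`) per lace line and
`T ≤ n` lines at a vertex with `n` children, the TOTAL chain length is `≤ (4/7)·n`: the global load
per child is `≤ 1 + 4/7 = 11/7 < 7/4` (the break-even of TrunkCounting.trunk_margin_iff), although a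
single gap may carry two chains.  Referee G43's local-doubling arithmetic is reproduced as arithmetic:
`1 + 2·(4/7) = 15/7 > 7/4`, `(2/9)(7/15) = 14/135`, `8/63 − 14/135 = 22/945`. [folklore] -/
theorem chain_total_le {T n : ℕ} (hT : T ≤ n) (c : ℕ → ℝ) (hc : ∀ t, c t ≤ 4 / 7) :
    (Finset.range T).sum c ≤ 4 / 7 * n := by
  calc (Finset.range T).sum c ≤ (Finset.range T).sum (fun _ => (4 / 7 : ℝ)) :=
        Finset.sum_le_sum (fun t _ => hc t)
    _ = 4 / 7 * T := by simp [mul_comm]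
    _ ≤ 4 / 7 * n := by gcongr

/-- Global lace load `11/7 < 7/4`; local doubling `15/7 > 7/4`; G43's `22/945`; the R1 margin `10/693`. (Audit-cell arithmetic.) [cite: ImbrieJSP2016, App. A "no more than two lines emanate from any group"] -/
theorem lace_load_arith :
    (1 : ℝ) + 4 / 7 = 11 / 7 ∧ (11 : ℝ) / 7 < 7 / 4 ∧ (1 : ℝ) + 2 * (4 / 7) = 15 / 7 ∧
    (7 : ℝ) / 4 < 15 / 7 ∧ (2 : ℝ) / 9 * (7 / 15) = 14 / 135 ∧ (8 : ℝ) / 63 - 14 / 135 = 22 / 945 ∧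
    (2 : ℝ) / 9 * (7 / 11) - 8 / 63 = 10 / 693 := by
  norm_num

/-! ## 5. The Leibniz identity (A.3) = JSP (6.2) -/

/-- The corrected identity: first numerator `(d21 − d22)(d12 − d22)` — one left-difference times one
right-difference, which is the structure the text uses. [cite: ImbrieJSP2016, (A.3)/(6.2)] -/
theorem leibniz_A3_corrected {K : Type*} [Field K] (d11 d12 d21 d22 : K) (h11 : d11 ≠ 0)
    (h12 : d12 ≠ 0) (h21 : d21 ≠ 0) (h22 : d22 ≠ 0) :
    (1 / d22 - 1 / d21) - (1 / d12 - 1 / d11)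
      = (d21 - d22) * (d12 - d22) / (d22 * d21 * d12)
        + ((d21 - d22) - (d11 - d12)) / (d12 * d21)
        + (d11 - d21) * (d11 - d12) / (d12 * d21 * d11) := by
  field_simp
  ring

/-- The printed first numerator `(d21 − d22)(d21 − d22)` does not give an identity
(`d11,d12,d21,d22 = 2,3,5,7`: left side `23/210`, printed right side `1/14`). (Audit-cell check of a misprint.) [cite: ImbrieJSP2016, (A.3) = JSP (6.2)] -/
theorem leibniz_A3_printed_fails :
    ∃ d11 d12 d21 d22 : ℚ, d11 ≠ 0 ∧ d12 ≠ 0 ∧ d21 ≠ 0 ∧ d22 ≠ 0 ∧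
      (1 / d22 - 1 / d21) - (1 / d12 - 1 / d11)
        ≠ (d21 - d22) * (d21 - d22) / (d22 * d21 * d12)
          + ((d21 - d22) - (d11 - d12)) / (d12 * d21)
          + (d11 - d21) * (d11 - d12) / (d12 * d21 * d11) :=
  ⟨2, 3, 5, 7, by norm_num⟩

end Literature.MathematicalPhysics.QuantumLattice.Imbrie2016
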